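import Literature.MathematicalPhysics.QuantumLattice.TorusGibbsTwoSectorEnergyEntropyBalance
import Literature.MathematicalPhysics.QuantumLattice.InfVolFermionStateTorusLimitEnergyEntropyBalance
import HarnessLib

/-!
# Two-sector (charged) energy–entropy balance rows for PAIRS of thermal torus-limit states of the
# `t–t'` Hubbard model: the canonical chemical potential in the thermodynamic limit

Topic `Literature/MathematicalPhysics/QuantumLattice`; the torus-limit companion of
`GibbsTwoSectorEnergyEntropyBalance.lean` / `TorusGibbsTwoSectorEnergyEntropyBalance.lean` in the
format of `InfVolFermionStateTorusLimitEnergyEntropyBalance.lean` (the ONE-sector linearised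
Araki–Sewell rows of thermal torus limits, for generators conserving `N` and `S^z`). The tree's thermal
object of record is a torus limit `ω` of the canonical Gibbs states of `H_L = hubbardTorusTT' L t t' U`
on ONE spin sector; the energy–entropy balance rows of a CHARGED local generator `A` (one that changes
`N` or `S^z`: the rows that carry the chemical potential in a thermal state relaxation) do not hold for
`ω` alone — they hold for the grand-canonical KMS object, and equivalence of ensembles is not in the
tree. What passes to the limit from the exact finite-volume two-sector rows is a statement about a PAIR
of torus limits taken along the SAME side sequence `Ls → ∞`: `ω` from the sector `P_L` of interest,
`ω'` from the image sector `P'_L` into which the torus embedding `ΓÃ` of the generator carries `P_L`,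
together with a limit point `r` of the ratio of canonical partition functions `Z_{P'_L}/Z_{P_L}`
(the exponential of `β` times the canonical chemical potential of the charge `A` removes):

  `0 ≤ β·Re ω_{Λ₁}(Ãᴴ(H_{Λ₁}Ã − ÃH_{Λ₁})) − s·Re ω_{Λ₁}(ÃᴴÃ) + q·r·Re ω'_{Λ₁}(ÃÃᴴ)`,  `e^{s−1} ≤ q`,

`Λ₁ = thicken Λ 1`, `Ã = Γ_{Λ⊆Λ₁}A` (§3, `re_expect_twoSector_eeb_nonneg_of_canonical_limits`; §1 is the
separated normalised row for transformed eigen-mixtures, §2 the torus average at fixed `L` for general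
sector predicates; §4 specialises the first sector to the convention of record
`IsTorusLimitOfMixture (sectorGibbsCount n) (sectorGibbsWeightTT' β t t' U n ·) (sectorGibbsVectorTT' t t' U n ·)`
and the second to a spin sector `(a'_L, b'_L)`). Joint limits exist along subsequences by
`InfVolFermionState.exists_isTorusLimitOfMixture_subseq` + `IsTorusLimitOfMixture.comp_tendsto`
(`TorusLimitOfMixturesCompactness`) and Bolzano–Weierstrass for the bounded ratio (its logarithm is
bracketed by `log_div_sub_div_le_log_partitionRatio` / `log_partitionRatio_le_log_div_add_div`); this
file proves the row GIVEN the joint data — the consumer (a two-state relaxation with one shared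
chemical-potential parameter per charge sector) quantifies over them.

HONEST SCOPE: rows for pairs of states; no claim that `ω' = ω`, that `r` is unique, or that the
one-particle chemical potentials of neighbouring sectors agree (each of these is an equivalence-of-
ensembles statement the tree does not have). The sector-mapping property of the embedded generator is
a hypothesis BY NAME at each side `L` (discharged per generator by the user, e.g. from
`apply_eq_zero_of_spinConfig_of_mulVec_mem`). Everything is PROVED; no definition, no named fact.

## Mathlib / tree search

REUSED: `sum_exp_mul_re_expect_twoSector_eeb_mulVec_nonneg`, `hubbardTorusTT'_apply_eq_zero_of_spinConfig`,
`fockTranslate_apply_eq_zero_of_spinConfig`, `fockTranslate_conjTranspose_apply_eq_zero_of_spinConfig`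
(`TorusGibbsTwoSectorEnergyEntropyBalance`); `fockTranslate_val_conjTranspose_mul_val_mul`,
`fockTranslate_val_mul_val_conjTranspose_mul`, `fockTranslate_apply_eq_zero_of_szConfig`,
`fockTranslate_val_conjTranspose_eq_neg` (`TorusGibbsEnergyEntropyBalance`);
`hubbardTorusTT'_commutator_fermionEmbed`, `torusAvgExpectAt_of_injOn`, `torusAvgExpect_eq`,
`eventually_injOn_proj_of_tendsto`, `fermionEmbed_mul/sub/conjTranspose`, `sectorGibbsIndex`,
`hubbardTorusTT'_apply_eq_zero_of_szConfig`, `canonicalWeight`, Mathlib `Filter.Tendsto.add/mul`,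
`ge_of_tendsto'`. `lean search 'twoSector.*Limit|charged.*torus limit'`: nothing (2026-08-27).

## References

* O. Bratteli, D. W. Robinson, *Operator Algebras and Quantum Statistical Mechanics 2* (1997),
  Thm. 5.3.15, §5.4.2. [cite: BratteliRobinsonII1997, Thm. 5.3.15]
* H. Fawzi, O. Fawzi, S. O. Scalet (2024), Thm. 3.1, §3.2. [cite: FawziFawziScalet2024, Thm. 3.1]
* H. Araki, H. Moriya, Rev. Math. Phys. 15 (2003) 93, Def. 6.3. [cite: ArakiMoriya2003, Def. 6.3]
* R. B. Israel, *Convexity in the Theory of Lattice Gases* (1979), §I.3 eq. (26), §III.1.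
  [cite: Israel1979, §I.3 eq. (26)]
-/

noncomputable section

namespace Literature.MathematicalPhysics.QuantumLattice

open Matrix Finset HubbardWave0 Literature.Probability.LatticeModels ThermodynamicLimit
open _root_.Filter
open scoped _root_.Topology ComplexOrder BigOperators

/-! ### §1 The separated, normalised two-sector row in transformed eigen-mixtures -/

section Separated

variable {ι : Type*} [Fintype ι] [DecidableEq ι] (p p' : ι → Prop) [DecidablePred p] [DecidablePred p']

/-- **Separated normalised two-sector row for transformed canonical eigen-mixtures.** Under the
hypotheses of `sum_exp_mul_re_expect_twoSector_eeb_mulVec_nonneg`, with canonical weights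
`w_a = e^{−βE_a}/Z_p`, `w'_b = e^{−βE'_b}/Z_{p'}` and `r = Z_{p'}/Z_p = (Σ_b e^{−βE'_b})/(Σ_a e^{−βE_a})`:
`0 ≤ β·Σ_a w_a Re⟨Uψ_a, Bᴴ(AB − BA) Uψ_a⟩ − s·Σ_a w_a Re⟨Uψ_a, BᴴB Uψ_a⟩ + q·r·Σ_b w'_b Re⟨Uψ'_b, BBᴴ Uψ'_b⟩`
for `e^{s−1} ≤ q`. [cite: FawziFawziScalet2024, Thm. 3.1] [cite: BratteliRobinsonII1997, §5.4.2] -/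
theorem twoSector_eeb_mulVec_separated_nonneg {A : Matrix ι ι ℂ} (hA : A.IsHermitian)
    (hinv : ∀ i j, ¬ p i → p j → A i j = 0) (hinv' : ∀ i j, ¬ p' i → p' j → A i j = 0)
    {U : Matrix ι ι ℂ} (hU : ∀ X : Matrix ι ι ℂ, Uᴴ * (U * X) = X)
    (hU' : ∀ X : Matrix ι ι ℂ, U * (Uᴴ * X) = X) (hUA : Commute U A)
    (hUp : ∀ i j, ¬ p i → p j → U i j = 0) (hUp' : ∀ i j, ¬ p i → p j → Uᴴ i j = 0)
    (hUq : ∀ i j, ¬ p' i → p' j → U i j = 0) (hUq' : ∀ i j, ¬ p' i → p' j → Uᴴ i j = 0)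
    {B : Matrix ι ι ℂ} (hB : ∀ i j, ¬ p' i → p j → B i j = 0)
    (hB' : ∀ i j, ¬ p i → p' j → Bᴴ i j = 0) (β : ℝ) {s q : ℝ} (hq : Real.exp (s - 1) ≤ q) :
    0 ≤ β * ∑ a, canonicalWeight β (sectorEigenvalue p A hA) a *
          (star (U *ᵥ sectorEigenvector p A hA a) ⬝ᵥ
            ((Bᴴ * (A * B - B * A)) *ᵥ (U *ᵥ sectorEigenvector p A hA a))).re -
        s * ∑ a, canonicalWeight β (sectorEigenvalue p A hA) a *
          (star (U *ᵥ sectorEigenvector p A hA a) ⬝ᵥ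
            ((Bᴴ * B) *ᵥ (U *ᵥ sectorEigenvector p A hA a))).re +
        q * ((∑ b, Real.exp (-(β * sectorEigenvalue p' A hA b))) /
              ∑ a, Real.exp (-(β * sectorEigenvalue p A hA a))) *
          ∑ b, canonicalWeight β (sectorEigenvalue p' A hA) b *
            (star (U *ᵥ sectorEigenvector p' A hA b) ⬝ᵥ
              ((B * Bᴴ) *ᵥ (U *ᵥ sectorEigenvector p' A hA b))).re := by
  have h := sum_exp_mul_re_expect_twoSector_eeb_mulVec_nonneg p p' hA hinv hinv' hU hU' hUA hUp hUp'
    hUq hUq' hB hB' β hq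
  -- separate the first block
  have hlin : ∀ a : Subtype p,
      (star (U *ᵥ sectorEigenvector p A hA a) ⬝ᵥ
        ((((β : ℝ) : ℂ) • (Bᴴ * (A * B - B * A)) - ((s : ℝ) : ℂ) • (Bᴴ * B)) *ᵥ
          (U *ᵥ sectorEigenvector p A hA a))).re =
      β * (star (U *ᵥ sectorEigenvector p A hA a) ⬝ᵥ
          ((Bᴴ * (A * B - B * A)) *ᵥ (U *ᵥ sectorEigenvector p A hA a))).re -
        s * (star (U *ᵥ sectorEigenvector p A hA a) ⬝ᵥ
          ((Bᴴ * B) *ᵥ (U *ᵥ sectorEigenvector p A hA a))).re := by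
    intro a
    rw [sub_mulVec, smul_mulVec, smul_mulVec, dotProduct_sub, dotProduct_smul,
      dotProduct_smul, Complex.sub_re, smul_eq_mul, smul_eq_mul, Complex.re_ofReal_mul,
      Complex.re_ofReal_mul]
  simp_rw [hlin] at h
  -- abbreviations
  set Z := ∑ a, Real.exp (-(β * sectorEigenvalue p A hA a)) with hZ
  set Z' := ∑ b, Real.exp (-(β * sectorEigenvalue p' A hA b)) with hZ'
  set S₁ := ∑ a, Real.exp (-(β * sectorEigenvalue p A hA a)) *
      (star (U *ᵥ sectorEigenvector p A hA a) ⬝ᵥ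
        ((Bᴴ * (A * B - B * A)) *ᵥ (U *ᵥ sectorEigenvector p A hA a))).re with hS₁
  set S₂ := ∑ a, Real.exp (-(β * sectorEigenvalue p A hA a)) *
      (star (U *ᵥ sectorEigenvector p A hA a) ⬝ᵥ
        ((Bᴴ * B) *ᵥ (U *ᵥ sectorEigenvector p A hA a))).re with hS₂
  set S₃ := ∑ b, Real.exp (-(β * sectorEigenvalue p' A hA b)) *
      (star (U *ᵥ sectorEigenvector p' A hA b) ⬝ᵥ
        ((B * Bᴴ) *ᵥ (U *ᵥ sectorEigenvector p' A hA b))).re with hS₃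
  have hsum : ∑ a, Real.exp (-(β * sectorEigenvalue p A hA a)) *
      (β * (star (U *ᵥ sectorEigenvector p A hA a) ⬝ᵥ
          ((Bᴴ * (A * B - B * A)) *ᵥ (U *ᵥ sectorEigenvector p A hA a))).re -
        s * (star (U *ᵥ sectorEigenvector p A hA a) ⬝ᵥ
          ((Bᴴ * B) *ᵥ (U *ᵥ sectorEigenvector p A hA a))).re) = β * S₁ - s * S₂ := by
    rw [hS₁, hS₂, Finset.mul_sum, Finset.mul_sum, ← Finset.sum_sub_distrib]
    exact Finset.sum_congr rfl fun a _ => by ring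
  rw [hsum] at h
  -- the normalised sums are `Z⁻¹ S₁`, `Z⁻¹ S₂`, `Z'⁻¹ S₃`
  have hw : ∀ a, canonicalWeight β (sectorEigenvalue p A hA) a =
      Z⁻¹ * Real.exp (-(β * sectorEigenvalue p A hA a)) := fun a => rfl
  have hw' : ∀ b, canonicalWeight β (sectorEigenvalue p' A hA) b =
      Z'⁻¹ * Real.exp (-(β * sectorEigenvalue p' A hA b)) := fun b => rfl
  simp_rw [hw, hw', mul_assoc, ← Finset.mul_sum]
  rw [← hS₁, ← hS₂, ← hS₃]
  have hZ0 : 0 ≤ Z := Finset.sum_nonneg fun _ _ => (Real.exp_pos _).le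
  rcases isEmpty_or_nonempty (Subtype p') with he | hne
  · have h0 : Z' = 0 := by rw [hZ']; exact Finset.sum_of_isEmpty _
    have h0' : S₃ = 0 := by rw [hS₃]; exact Finset.sum_of_isEmpty _
    rw [h0'] at h ⊢
    rw [mul_zero, add_zero] at h
    rw [mul_zero, mul_zero, mul_zero, add_zero]
    have := mul_nonneg (inv_nonneg.2 hZ0) h
    nlinarith [this]
  · have hZ'pos : 0 < Z' := Finset.sum_pos (fun _ _ => Real.exp_pos _) Finset.univ_nonempty
    have hcancel : q * (Z' / Z * (Z'⁻¹ * S₃)) = Z⁻¹ * (q * S₃) := by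
      calc q * (Z' / Z * (Z'⁻¹ * S₃)) = (Z' * Z'⁻¹) * (Z⁻¹ * (q * S₃)) := by ring
        _ = Z⁻¹ * (q * S₃) := by rw [mul_inv_cancel₀ hZ'pos.ne', one_mul]
    rw [hcancel]
    have := mul_nonneg (inv_nonneg.2 hZ0) h
    nlinarith [this]

end Separated

/-! ### §2 Torus averages at fixed side `L`, general sector predicates -/

section TorusAverage

variable (L : ℕ) [NeZero L] (t t' U β : ℝ)

/-- Real part of a weighted translation average of per-translate expectations:
`Re Σ_c (w_c : ℂ)·(N⁻¹ Σ_v f(c,v)) = N⁻¹ Σ_v Σ_c w_c Re f(c,v)`. [folklore] -/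
private theorem re_sum_mul_avg {κ : Type*} [Fintype κ] (w : κ → ℝ) (N : ℕ)
    (f : κ → TorusSite 2 L → ℂ) :
    (∑ c, (w c : ℂ) * (((N : ℂ))⁻¹ * ∑ v, f c v)).re = (N : ℝ)⁻¹ * ∑ v, ∑ c, w c * (f c v).re := by
  have hcast : ((N : ℂ))⁻¹ = (((N : ℝ)⁻¹ : ℝ) : ℂ) := by push_cast; rfl
  rw [Complex.re_sum]
  simp_rw [hcast, ← mul_assoc, ← Complex.ofReal_mul, Complex.re_ofReal_mul, Complex.re_sum, Finset.mul_sum]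
  rw [Finset.sum_comm]
  refine Finset.sum_congr rfl fun v _ => Finset.sum_congr rfl fun c _ => by ring

/-- **Two-sector rows for the torus-averaged canonical Gibbs mixtures at side `L` (general sector
predicates).** Let `P`, `P'` be decidable predicates on the torus occupation configurations such that
`H_L = hubbardTorusTT' L t t' U` and every translation `U_v` (and `U_vᴴ`) have no entries from either
into its complement (e.g. spin sectors, `hubbardTorusTT'_apply_eq_zero_of_spinConfig`,
`fockTranslate_apply_eq_zero_of_spinConfig`). Let `Λ₁ = thicken Λ 1` with `x ↦ x mod L` injective on
`thicken Λ₁ 1`, `A ∈ 𝔄_Λ`, `Ã = Γ_{Λ⊆Λ₁}A`, and suppose the torus embedding `B = Γ_{Λ₁}Ã` has no entries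
from `P` into the complement of `P'` and `Bᴴ` none from `P'` into the complement of `P` (a generator of
definite charge, `P'` its image sector). With the canonical eigen-data `(w_c, ψ_c)` of `H_L|_P` and
`(w'_d, ψ'_d)` of `H_L|_{P'}`, `r = Z_{P'}/Z_P`, and `e^{s−1} ≤ q`:
`0 ≤ β·Re Σ_c w_c·⟨Ãᴴ(H_{Λ₁}Ã − ÃH_{Λ₁})⟩^{avg}_{ψ_c} − s·Re Σ_c w_c·⟨ÃᴴÃ⟩^{avg}_{ψ_c} + q·r·Re Σ_d w'_d·⟨ÃÃᴴ⟩^{avg}_{ψ'_d}`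
(`⟨X⟩^{avg}_ψ = torusAvgExpectAt L Λ₁ X ψ`; the commutator is pulled back into the torus by
`hubbardTorusTT'_commutator_fermionEmbed`). [cite: FawziFawziScalet2024, Thm. 3.1]
[cite: BratteliRobinsonII1997, §5.4.2] -/
theorem twoSector_eeb_torusAvgExpectAt_nonneg
    (P P' : Finset (Orb (FermionTorus 2 L)) → Prop) [DecidablePred P] [DecidablePred P']
    (hP : ∀ s s', ¬ P s → P s' → hubbardTorusTT' L t t' U s s' = 0)
    (hP' : ∀ s s', ¬ P' s → P' s' → hubbardTorusTT' L t t' U s s' = 0)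
    (hUP : ∀ (v : TorusSite 2 L) s s', ¬ P s → P s' → (fockTranslate v).val s s' = 0)
    (hUP' : ∀ (v : TorusSite 2 L) s s', ¬ P' s → P' s' → (fockTranslate v).val s s' = 0)
    {Λ : Finset (Site 2)} (h₁ : Set.InjOn (Torus.proj (d := 2) L) ↑(thicken Λ 1))
    (hInj : Set.InjOn (Torus.proj (d := 2) L) ↑(thicken (thicken Λ 1) 1)) (A : FermionOp Λ)
    (hB : ∀ s s', ¬ P' s → P s' →
      fermionEmbed (PolySite.toTorusEmb L h₁) (fermionEmbed (PolySite.incl (subset_thicken Λ 1)) A) s s' = 0)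
    (hB' : ∀ s s', ¬ P s → P' s' →
      (fermionEmbed (PolySite.toTorusEmb L h₁) (fermionEmbed (PolySite.incl (subset_thicken Λ 1)) A))ᴴ s s' = 0)
    {s q : ℝ} (hq : Real.exp (s - 1) ≤ q) :
    0 ≤ β * (∑ c, (canonicalWeight β (sectorEigenvalue P (hubbardTorusTT' L t t' U)
            (hubbardTorusTT'_isHermitian L t t' U)) c : ℂ) *
          torusAvgExpectAt L (thicken Λ 1)
            ((fermionEmbed (PolySite.incl (subset_thicken Λ 1)) A)ᴴ *
              ((hubbardTTPrimeFermionInteraction t t' U).localHamiltonian (thicken Λ 1) *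
                  fermionEmbed (PolySite.incl (subset_thicken Λ 1)) A -
                fermionEmbed (PolySite.incl (subset_thicken Λ 1)) A *
                  (hubbardTTPrimeFermionInteraction t t' U).localHamiltonian (thicken Λ 1)))
            (sectorEigenvector P (hubbardTorusTT' L t t' U) (hubbardTorusTT'_isHermitian L t t' U) c)).re -
        s * (∑ c, (canonicalWeight β (sectorEigenvalue P (hubbardTorusTT' L t t' U)
            (hubbardTorusTT'_isHermitian L t t' U)) c : ℂ) *
          torusAvgExpectAt L (thicken Λ 1)
            ((fermionEmbed (PolySite.incl (subset_thicken Λ 1)) A)ᴴ *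
              fermionEmbed (PolySite.incl (subset_thicken Λ 1)) A)
            (sectorEigenvector P (hubbardTorusTT' L t t' U) (hubbardTorusTT'_isHermitian L t t' U) c)).re +
        q * ((∑ d, Real.exp (-(β * sectorEigenvalue P' (hubbardTorusTT' L t t' U)
              (hubbardTorusTT'_isHermitian L t t' U) d))) /
            ∑ c, Real.exp (-(β * sectorEigenvalue P (hubbardTorusTT' L t t' U)
              (hubbardTorusTT'_isHermitian L t t' U) c))) *
          (∑ d, (canonicalWeight β (sectorEigenvalue P' (hubbardTorusTT' L t t' U)
              (hubbardTorusTT'_isHermitian L t t' U)) d : ℂ) *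
            torusAvgExpectAt L (thicken Λ 1)
              (fermionEmbed (PolySite.incl (subset_thicken Λ 1)) A *
                (fermionEmbed (PolySite.incl (subset_thicken Λ 1)) A)ᴴ)
              (sectorEigenvector P' (hubbardTorusTT' L t t' U) (hubbardTorusTT'_isHermitian L t t' U) d)).re := by
  set H := hubbardTorusTT' L t t' U with hHdef
  set hH := hubbardTorusTT'_isHermitian L t t' U with hhH
  set At := fermionEmbed (PolySite.incl (subset_thicken Λ 1)) A with hAt
  set B := fermionEmbed (PolySite.toTorusEmb L h₁) At with hBdef
  -- pull the three observables back into the torus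
  have hΓ₁ : fermionEmbed (PolySite.toTorusEmb L h₁)
      (Atᴴ * ((hubbardTTPrimeFermionInteraction t t' U).localHamiltonian (thicken Λ 1) * At -
        At * (hubbardTTPrimeFermionInteraction t t' U).localHamiltonian (thicken Λ 1))) =
      Bᴴ * (H * B - B * H) := by
    rw [fermionEmbed_mul, fermionEmbed_conjTranspose, hAt,
      ← hubbardTorusTT'_commutator_fermionEmbed L t t' U (subset_thicken Λ 1) subset_rfl hInj A]
  have hΓ₂ : fermionEmbed (PolySite.toTorusEmb L h₁) (Atᴴ * At) = Bᴴ * B := by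
    rw [fermionEmbed_mul, fermionEmbed_conjTranspose]
  have hΓ₃ : fermionEmbed (PolySite.toTorusEmb L h₁) (At * Atᴴ) = B * Bᴴ := by
    rw [fermionEmbed_mul, fermionEmbed_conjTranspose]
  -- each translate: the separated normalised two-sector row
  have hv : ∀ v : TorusSite 2 L,
      0 ≤ β * ∑ c, canonicalWeight β (sectorEigenvalue P H hH) c *
            (expect (Bᴴ * (H * B - B * H)) ((fockTranslate v).val *ᵥ sectorEigenvector P H hH c)).re -
          s * ∑ c, canonicalWeight β (sectorEigenvalue P H hH) c *
            (expect (Bᴴ * B) ((fockTranslate v).val *ᵥ sectorEigenvector P H hH c)).re +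
          q * ((∑ d, Real.exp (-(β * sectorEigenvalue P' H hH d))) /
                ∑ c, Real.exp (-(β * sectorEigenvalue P H hH c))) *
            ∑ d, canonicalWeight β (sectorEigenvalue P' H hH) d *
              (expect (B * Bᴴ) ((fockTranslate v).val *ᵥ sectorEigenvector P' H hH d)).re := by
    intro v
    have hUP'' : ∀ s s', ¬ P s → P s' → (fockTranslate v).valᴴ s s' = 0 := by
      intro s s' hs hs'
      rw [fockTranslate_val_conjTranspose_eq_neg]
      exact hUP (-v) s s' hs hs'
    have hUQ'' : ∀ s s', ¬ P' s → P' s' → (fockTranslate v).valᴴ s s' = 0 := by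
      intro s s' hs hs'
      rw [fockTranslate_val_conjTranspose_eq_neg]
      exact hUP' (-v) s s' hs hs'
    exact twoSector_eeb_mulVec_separated_nonneg P P' hH hP hP'
      (fockTranslate_val_conjTranspose_mul_val_mul L v) (fockTranslate_val_mul_val_conjTranspose_mul L v)
      (fockTranslate_commute_hubbardTorusTT' L v t t' U) (hUP v) hUP'' (hUP' v) hUQ'' hB hB' β hq
  -- the torus averages
  simp_rw [torusAvgExpectAt_of_injOn L h₁, hΓ₁, hΓ₂, hΓ₃, re_sum_mul_avg]
  set N := Fintype.card (TorusSite 2 L) with hN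
  have hN0 : 0 ≤ (N : ℝ)⁻¹ := inv_nonneg.2 (Nat.cast_nonneg _)
  set S₁ := fun v : TorusSite 2 L => ∑ c, canonicalWeight β (sectorEigenvalue P H hH) c *
      (expect (Bᴴ * (H * B - B * H)) ((fockTranslate v).val *ᵥ sectorEigenvector P H hH c)).re with hS₁
  set S₂ := fun v : TorusSite 2 L => ∑ c, canonicalWeight β (sectorEigenvalue P H hH) c *
      (expect (Bᴴ * B) ((fockTranslate v).val *ᵥ sectorEigenvector P H hH c)).re with hS₂
  set S₃ := fun v : TorusSite 2 L => ∑ d, canonicalWeight β (sectorEigenvalue P' H hH) d *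
      (expect (B * Bᴴ) ((fockTranslate v).val *ᵥ sectorEigenvector P' H hH d)).re with hS₃
  set r := (∑ d, Real.exp (-(β * sectorEigenvalue P' H hH d))) /
      ∑ c, Real.exp (-(β * sectorEigenvalue P H hH c)) with hr
  have hv' : ∀ v, 0 ≤ β * S₁ v - s * S₂ v + q * r * S₃ v := fun v => by
    have := hv v
    simp only [hS₁, hS₂, hS₃, hr]
    linarith
  have hsum : 0 ≤ ∑ v, (N : ℝ)⁻¹ * (β * S₁ v - s * S₂ v + q * r * S₃ v) :=
    Finset.sum_nonneg fun v _ => mul_nonneg hN0 (hv' v)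
  have hexp : ∑ v, (N : ℝ)⁻¹ * (β * S₁ v - s * S₂ v + q * r * S₃ v) =
      β * ((N : ℝ)⁻¹ * ∑ v, S₁ v) - s * ((N : ℝ)⁻¹ * ∑ v, S₂ v) + q * r * ((N : ℝ)⁻¹ * ∑ v, S₃ v) := by
    rw [Finset.mul_sum, Finset.mul_sum, Finset.mul_sum, Finset.mul_sum, Finset.mul_sum, Finset.mul_sum,
      ← Finset.sum_sub_distrib, ← Finset.sum_add_distrib]
    exact Finset.sum_congr rfl fun v _ => by ring
  rw [hexp] at hsum
  simpa only [hS₁, hS₂, hS₃] using hsum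

end TorusAverage

/-! ### §3 The rows of a PAIR of thermal torus limits along a common side sequence -/

section Limit

variable (t t' U β : ℝ)

/-- Reindexing a weighted sum of torus averages along an enumeration of the sector. [folklore] -/
private theorem sum_reindex_torusAvg {L : ℕ} [NeZero L] {P : Finset (Orb (FermionTorus 2 L)) → Prop}
    [DecidablePred P] {m : ℕ} (e : Fin m ≃ Subtype P) (w : Subtype P → ℝ)
    (φ : Subtype P → Fock (Orb (FermionTorus 2 L))) {p : Fin m → ℝ}
    {ψ : Fin m → Fock (Orb (FermionTorus 2 L))} (hp : ∀ i, p i = w (e i)) (hψ : ∀ i, ψ i = φ (e i))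
    {Λ : Finset (Site 2)} (X : FermionOp Λ) :
    ∑ i, (p i : ℂ) * torusAvgExpect L Λ X (ψ i) = ∑ c, (w c : ℂ) * torusAvgExpectAt L Λ X (φ c) := by
  simp_rw [torusAvgExpect_eq, hp, hψ]
  exact Equiv.sum_comp e (fun c => (w c : ℂ) * torusAvgExpectAt L Λ X (φ c))

/-- **Two-sector (charged) energy–entropy balance rows for a pair of thermal torus limits.** Let
`P_L`, `P'_L` be decidable sector predicates on the torus configurations at every side `L` such that
`H_L = hubbardTorusTT' L t t' U` and the translations `U_v` have no entries from either sector into its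
complement. Let `(m, p, ψ)`, `(m', p', ψ')` be the canonical Gibbs eigen-mixtures of `H_L|_{P_L}`,
`H_L|_{P'_L}` at inverse temperature `β` (weights `canonicalWeight`, vectors `sectorEigenvector`, in ANY
enumerations `e_L`, `e'_L`), let `ω`, `ω'` be torus limits of the two mixtures along the SAME `Ls → ∞`, and
let `r` be the limit along `Ls` of the ratio `Z_{P'_L}/Z_{P_L}` of canonical partition functions. Let
`A ∈ 𝔄_Λ`, `Λ₁ = thicken Λ 1`, `Ã = Γ_{Λ⊆Λ₁}A`, and suppose that at every side the torus embedding
`Γ_{Λ₁}Ã` has no entries from `P_L` into the complement of `P'_L` and its adjoint none from `P'_L` into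
the complement of `P_L` (a local generator of definite charge; hypotheses by name). Then for all real
`s, q` with `e^{s−1} ≤ q`:
`0 ≤ β·Re ω_{Λ₁}(Ãᴴ(H^{tt'U}_{Λ₁}Ã − ÃH^{tt'U}_{Λ₁})) − s·Re ω_{Λ₁}(ÃᴴÃ) + q·r·Re ω'_{Λ₁}(ÃÃᴴ)` —
the grand-canonical linearised EEB row of the charged generator `A`, with `e^{βμ}` replaced by the
limiting ratio of CANONICAL partition functions and `ÃÃᴴ` read in the companion limit `ω'` of the image
sector. [cite: FawziFawziScalet2024, Thm. 3.1] [cite: BratteliRobinsonII1997, §5.4.2] -/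
theorem InfVolFermionState.re_expect_twoSector_eeb_nonneg_of_canonical_limits
    (P P' : ∀ L : ℕ, Finset (Orb (FermionTorus 2 L)) → Prop)
    [hdP : ∀ L, DecidablePred (P L)] [hdP' : ∀ L, DecidablePred (P' L)]
    (hP : ∀ L s s', ¬ P L s → P L s' → hubbardTorusTT' L t t' U s s' = 0)
    (hP' : ∀ L s s', ¬ P' L s → P' L s' → hubbardTorusTT' L t t' U s s' = 0)
    (hUP : ∀ (L : ℕ) [NeZero L] (v : TorusSite 2 L) s s', ¬ P L s → P L s' → (fockTranslate v).val s s' = 0)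
    (hUP' : ∀ (L : ℕ) [NeZero L] (v : TorusSite 2 L) s s', ¬ P' L s → P' L s' → (fockTranslate v).val s s' = 0)
    {m m' : ℕ → ℕ} {p : ∀ L, Fin (m L) → ℝ} {ψ : ∀ L, Fin (m L) → Fock (Orb (FermionTorus 2 L))}
    {p' : ∀ L, Fin (m' L) → ℝ} {ψ' : ∀ L, Fin (m' L) → Fock (Orb (FermionTorus 2 L))}
    (e : ∀ L, Fin (m L) ≃ Subtype (P L)) (e' : ∀ L, Fin (m' L) ≃ Subtype (P' L))
    (hp : ∀ L i, p L i = canonicalWeight β (sectorEigenvalue (P L) (hubbardTorusTT' L t t' U)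
      (hubbardTorusTT'_isHermitian L t t' U)) (e L i))
    (hψ : ∀ L i, ψ L i = sectorEigenvector (P L) (hubbardTorusTT' L t t' U)
      (hubbardTorusTT'_isHermitian L t t' U) (e L i))
    (hp' : ∀ L i, p' L i = canonicalWeight β (sectorEigenvalue (P' L) (hubbardTorusTT' L t t' U)
      (hubbardTorusTT'_isHermitian L t t' U)) (e' L i))
    (hψ' : ∀ L i, ψ' L i = sectorEigenvector (P' L) (hubbardTorusTT' L t t' U)
      (hubbardTorusTT'_isHermitian L t t' U) (e' L i))
    {Ls : ℕ → ℕ} (hLs : Tendsto Ls atTop atTop) {ω ω' : InfVolFermionState 2}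
    (hω : ω.IsTorusLimitOfMixture m p ψ Ls) (hω' : ω'.IsTorusLimitOfMixture m' p' ψ' Ls)
    {r : ℝ} (hr : Tendsto (fun j =>
      (∑ d, Real.exp (-(β * sectorEigenvalue (P' (Ls j)) (hubbardTorusTT' (Ls j) t t' U)
          (hubbardTorusTT'_isHermitian (Ls j) t t' U) d))) /
        ∑ c, Real.exp (-(β * sectorEigenvalue (P (Ls j)) (hubbardTorusTT' (Ls j) t t' U)
          (hubbardTorusTT'_isHermitian (Ls j) t t' U) c))) atTop (𝓝 r))
    {Λ : Finset (Site 2)} (A : FermionOp Λ)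
    (hB : ∀ (L : ℕ) [NeZero L] (h₁ : Set.InjOn (Torus.proj (d := 2) L) ↑(thicken Λ 1)) s s',
      ¬ P' L s → P L s' →
        fermionEmbed (PolySite.toTorusEmb L h₁) (fermionEmbed (PolySite.incl (subset_thicken Λ 1)) A) s s' = 0)
    (hB' : ∀ (L : ℕ) [NeZero L] (h₁ : Set.InjOn (Torus.proj (d := 2) L) ↑(thicken Λ 1)) s s',
      ¬ P L s → P' L s' →
        (fermionEmbed (PolySite.toTorusEmb L h₁) (fermionEmbed (PolySite.incl (subset_thicken Λ 1)) A))ᴴ s s' = 0)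
    {s q : ℝ} (hq : Real.exp (s - 1) ≤ q) :
    0 ≤ β * (ω.expect (thicken Λ 1)
          ((fermionEmbed (PolySite.incl (subset_thicken Λ 1)) A)ᴴ *
            ((hubbardTTPrimeFermionInteraction t t' U).localHamiltonian (thicken Λ 1) *
                fermionEmbed (PolySite.incl (subset_thicken Λ 1)) A -
              fermionEmbed (PolySite.incl (subset_thicken Λ 1)) A *
                (hubbardTTPrimeFermionInteraction t t' U).localHamiltonian (thicken Λ 1)))).re -
        s * (ω.expect (thicken Λ 1)
          ((fermionEmbed (PolySite.incl (subset_thicken Λ 1)) A)ᴴ *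
            fermionEmbed (PolySite.incl (subset_thicken Λ 1)) A)).re +
        q * r * (ω'.expect (thicken Λ 1)
          (fermionEmbed (PolySite.incl (subset_thicken Λ 1)) A *
            (fermionEmbed (PolySite.incl (subset_thicken Λ 1)) A)ᴴ)).re := by
  set At := fermionEmbed (PolySite.incl (subset_thicken Λ 1)) A with hAt
  set X₁ : FermionOp (thicken Λ 1) := Atᴴ *
      ((hubbardTTPrimeFermionInteraction t t' U).localHamiltonian (thicken Λ 1) * At -
        At * (hubbardTTPrimeFermionInteraction t t' U).localHamiltonian (thicken Λ 1)) with hX₁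
  set X₂ : FermionOp (thicken Λ 1) := Atᴴ * At with hX₂
  set X₃ : FermionOp (thicken Λ 1) := At * Atᴴ with hX₃
  -- the three convergent sequences and their combination
  have h₁ := (Complex.continuous_re.tendsto _).comp (hω (thicken Λ 1) X₁)
  have h₂ := (Complex.continuous_re.tendsto _).comp (hω (thicken Λ 1) X₂)
  have h₃ := (Complex.continuous_re.tendsto _).comp (hω' (thicken Λ 1) X₃)
  have hlim : Tendsto (fun j =>
      β * (∑ i, (p (Ls j) i : ℂ) * torusAvgExpect (Ls j) (thicken Λ 1) X₁ (ψ (Ls j) i)).re -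
        s * (∑ i, (p (Ls j) i : ℂ) * torusAvgExpect (Ls j) (thicken Λ 1) X₂ (ψ (Ls j) i)).re +
        q * ((∑ d, Real.exp (-(β * sectorEigenvalue (P' (Ls j)) (hubbardTorusTT' (Ls j) t t' U)
              (hubbardTorusTT'_isHermitian (Ls j) t t' U) d))) /
            ∑ c, Real.exp (-(β * sectorEigenvalue (P (Ls j)) (hubbardTorusTT' (Ls j) t t' U)
              (hubbardTorusTT'_isHermitian (Ls j) t t' U) c))) *
          (∑ i, (p' (Ls j) i : ℂ) * torusAvgExpect (Ls j) (thicken Λ 1) X₃ (ψ' (Ls j) i)).re)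
      atTop (𝓝 (β * (ω.expect (thicken Λ 1) X₁).re - s * (ω.expect (thicken Λ 1) X₂).re +
        q * r * (ω'.expect (thicken Λ 1) X₃).re)) := by
    have h₃' := (hr.const_mul q).mul h₃
    simp only [Function.comp_def] at h₁ h₂ h₃ h₃'
    exact ((h₁.const_mul β).sub (h₂.const_mul s)).add h₃'
  refine ge_of_tendsto hlim ?_
  filter_upwards [eventually_injOn_proj_of_tendsto (thicken (thicken Λ 1) 1) hLs, hLs.eventually_ge_atTop 1]
    with j hInj hj
  haveI : NeZero (Ls j) := ⟨by omega⟩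
  have h₁' : Set.InjOn (Torus.proj (d := 2) (Ls j)) ↑(thicken Λ 1) :=
    hInj.mono (by exact_mod_cast subset_thicken (thicken Λ 1) 1)
  rw [sum_reindex_torusAvg (e (Ls j)) _ _ (hp (Ls j)) (hψ (Ls j)) X₁,
    sum_reindex_torusAvg (e (Ls j)) _ _ (hp (Ls j)) (hψ (Ls j)) X₂,
    sum_reindex_torusAvg (e' (Ls j)) _ _ (hp' (Ls j)) (hψ' (Ls j)) X₃]
  exact twoSector_eeb_torusAvgExpectAt_nonneg (Ls j) t t' U β (P (Ls j)) (P' (Ls j)) (hP (Ls j))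
    (hP' (Ls j)) (hUP (Ls j)) (hUP' (Ls j)) h₁' hInj A (hB (Ls j) h₁') (hB' (Ls j) h₁') hq

end Limit

/-! ### §4 The convention of record: first sector `(rectN n L, S^z = 0)`, image sector `(a'_L, b'_L)` -/

section Record

variable (t t' U β : ℝ)

/-- Canonical weights are invariant under reindexing the family of energies. [folklore] -/
private theorem canonicalWeight_comp_equiv' {κ κ' : Type*} [Fintype κ] [Fintype κ'] (e : κ' ≃ κ)
    (β : ℝ) (E : κ → ℝ) (a : κ') :
    canonicalWeight β (E ∘ e) a = canonicalWeight β E (e a) := by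
  unfold canonicalWeight
  rw [show (∑ b, Real.exp (-(β * (E ∘ e) b))) = ∑ b, Real.exp (-(β * E b)) from
    Equiv.sum_comp e (fun b => Real.exp (-(β * E b)))]
  rfl

/-- **From sector-mapping to matrix entries (two sectors).** If `B` maps a coordinate subspace
`K = {v | v = 0 off P}` into `K' = {v | v = 0 off P'}`, then `B` has no entries from `P` into the
complement of `P'`. [cite: Tasaki2020, §2.2] -/
theorem apply_eq_zero_off_of_mulVec_mem₂ {ι : Type*} [Fintype ι] [DecidableEq ι] (P P' : ι → Prop)
    (K K' : Submodule ℂ (ι → ℂ)) (hK : ∀ v, v ∈ K ↔ ∀ i, ¬ P i → v i = 0)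
    (hK' : ∀ v, v ∈ K' ↔ ∀ i, ¬ P' i → v i = 0) {B : Matrix ι ι ℂ} (hBK : ∀ v ∈ K, B *ᵥ v ∈ K')
    (i j : ι) (hi : ¬ P' i) (hj : P j) : B i j = 0 := by
  have hej : (Pi.single j (1 : ℂ) : ι → ℂ) ∈ K := by
    refine (hK _).2 fun i' hi' => ?_
    have hne : i' ≠ j := fun h => hi' (h ▸ hj)
    rw [Pi.single_apply, if_neg hne]
  have h := (hK' _).1 (hBK _ hej) i hi
  rwa [Matrix.mulVec_single_one, Matrix.col_apply] at h

/-- **Charged energy–entropy balance rows for the thermal object of record, in two-state form.** Let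
`ω` be a torus limit of the canonical Gibbs states of `hubbardTorusTT' (Ls j) t t' U` at inverse
temperature `β` on the sectors `(rectN n (Ls j), S^z = 0)` along `Ls → ∞` (the tree's thermal
convention), let `ω'` be a torus limit ALONG THE SAME `Ls` of the canonical Gibbs states on the spin
sectors `(N↑, N↓) = (a'_L, b'_L)` (the image sectors of the generator, e.g. `(k_L − 1, k_L)` for
`A = c_{x↑}`, `k_L = halfRectN n L`), and let `r = lim_j Z_{(a',b')}(Ls j)/Z_{(k,k)}(Ls j)`. If the torus
embedding of `Ã = Γ_{Λ⊆Λ₁}A` maps `szSector (rectN n L) 0` into `szSector (a'_L + b'_L) ((a'_L − b'_L)/2)`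
and its adjoint maps back, at every side `L`, then for `e^{s−1} ≤ q`:
`0 ≤ β·Re ω_{Λ₁}(Ãᴴ(H_{Λ₁}Ã − ÃH_{Λ₁})) − s·Re ω_{Λ₁}(ÃᴴÃ) + q·r·Re ω'_{Λ₁}(ÃÃᴴ)`.
Joint data `(ω', r)` exist along a subsequence of any `Ls` (compactness); a relaxation that wants the
charged rows of the canonical object carries one copy of its moment variables per image sector and one
parameter `r` per charge, bracketed a priori by `log_div_sub_div_le_log_partitionFn_ratio_torus` /
`log_partitionFn_ratio_le_log_div_add_div_torus`. [cite: FawziFawziScalet2024, Thm. 3.1]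
[cite: BratteliRobinsonII1997, §5.4.2] [cite: ArakiMoriya2003, Def. 6.3] -/
theorem InfVolFermionState.IsTorusLimitOfMixture.re_expect_twoSector_eeb_nonneg_of_sectorGibbs
    {n : ℝ} {Ls : ℕ → ℕ} (hLs : Tendsto Ls atTop atTop) {ω ω' : InfVolFermionState 2}
    (hω : ω.IsTorusLimitOfMixture (sectorGibbsCount n) (fun L => sectorGibbsWeightTT' β t t' U n L)
      (fun L => sectorGibbsVectorTT' t t' U n L) Ls)
    (a' b' : ℕ → ℕ)
    (hω' : ω'.IsTorusLimitOfMixture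
      (fun L => Fintype.card (Subtype (spinConfig (Λ := FermionTorus 2 L) (a' L) (b' L))))
      (fun L i => canonicalWeight β (sectorEigenvalue (spinConfig (a' L) (b' L)) (hubbardTorusTT' L t t' U)
        (hubbardTorusTT'_isHermitian L t t' U)) ((Fintype.equivFin _).symm i))
      (fun L i => sectorEigenvector (spinConfig (a' L) (b' L)) (hubbardTorusTT' L t t' U)
        (hubbardTorusTT'_isHermitian L t t' U) ((Fintype.equivFin _).symm i)) Ls)
    {r : ℝ} (hr : Tendsto (fun j =>
      (∑ d, Real.exp (-(β * sectorEigenvalue (spinConfig (a' (Ls j)) (b' (Ls j)))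
          (hubbardTorusTT' (Ls j) t t' U) (hubbardTorusTT'_isHermitian (Ls j) t t' U) d))) /
        ∑ c, Real.exp (-(β * sectorEigenvalue (szConfig n (Ls j)) (hubbardTorusTT' (Ls j) t t' U)
          (hubbardTorusTT'_isHermitian (Ls j) t t' U) c))) atTop (𝓝 r))
    {Λ : Finset (Site 2)} (A : FermionOp Λ)
    (hBK : ∀ (L : ℕ) [NeZero L] (h₁ : Set.InjOn (Torus.proj (d := 2) L) ↑(thicken Λ 1)),
      ∀ w ∈ szSector (rectN n L) (0 : ℝ),
        fermionEmbed (PolySite.toTorusEmb L h₁) (fermionEmbed (PolySite.incl (subset_thicken Λ 1)) A) *ᵥ w ∈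
          szSector (a' L + b' L) (((a' L : ℝ) - b' L) / 2))
    (hBK' : ∀ (L : ℕ) [NeZero L] (h₁ : Set.InjOn (Torus.proj (d := 2) L) ↑(thicken Λ 1)),
      ∀ w ∈ szSector (a' L + b' L) (((a' L : ℝ) - b' L) / 2),
        (fermionEmbed (PolySite.toTorusEmb L h₁) (fermionEmbed (PolySite.incl (subset_thicken Λ 1)) A))ᴴ *ᵥ w ∈
          szSector (rectN n L) (0 : ℝ))
    {s q : ℝ} (hq : Real.exp (s - 1) ≤ q) :
    0 ≤ β * (ω.expect (thicken Λ 1)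
          ((fermionEmbed (PolySite.incl (subset_thicken Λ 1)) A)ᴴ *
            ((hubbardTTPrimeFermionInteraction t t' U).localHamiltonian (thicken Λ 1) *
                fermionEmbed (PolySite.incl (subset_thicken Λ 1)) A -
              fermionEmbed (PolySite.incl (subset_thicken Λ 1)) A *
                (hubbardTTPrimeFermionInteraction t t' U).localHamiltonian (thicken Λ 1)))).re -
        s * (ω.expect (thicken Λ 1)
          ((fermionEmbed (PolySite.incl (subset_thicken Λ 1)) A)ᴴ *
            fermionEmbed (PolySite.incl (subset_thicken Λ 1)) A)).re +
        q * r * (ω'.expect (thicken Λ 1)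
          (fermionEmbed (PolySite.incl (subset_thicken Λ 1)) A *
            (fermionEmbed (PolySite.incl (subset_thicken Λ 1)) A)ᴴ)).re := by
  refine InfVolFermionState.re_expect_twoSector_eeb_nonneg_of_canonical_limits t t' U β
    (fun L => szConfig n L) (fun L => spinConfig (Λ := FermionTorus 2 L) (a' L) (b' L))
    (fun L s s' hs hs' => hubbardTorusTT'_apply_eq_zero_of_szConfig L t t' U n s s' hs hs')
    (fun L s s' hs hs' => hubbardTorusTT'_apply_eq_zero_of_spinConfig L t t' U (a' L) (b' L) s s' hs hs')
    (fun L _ v s s' hs hs' => fockTranslate_apply_eq_zero_of_szConfig L v n s s' hs hs')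
    (fun L _ v s s' hs hs' => fockTranslate_apply_eq_zero_of_spinConfig L v (a' L) (b' L) s s' hs hs')
    (fun L => sectorGibbsIndex n L) (fun L => (Fintype.equivFin _).symm)
    (fun L i => ?_) (fun L i => rfl) (fun L i => rfl) (fun L i => rfl) hLs hω hω' hr A
    (fun L _ h₁ s s' hs hs' => ?_) (fun L _ h₁ s s' hs hs' => ?_) hq
  · -- the weights of record are the canonical weights, reindexed
    rw [sectorGibbsWeightTT', show sectorGibbsEnergyTT' t t' U n L =
      sectorEigenvalue (szConfig n L) (hubbardTorusTT' L t t' U) (hubbardTorusTT'_isHermitian L t t' U) ∘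
        sectorGibbsIndex n L from rfl, canonicalWeight_comp_equiv']
  · exact apply_eq_zero_off_of_mulVec_mem₂ (szConfig n L) (spinConfig (a' L) (b' L))
      (szSector (rectN n L) 0) (szSector (a' L + b' L) (((a' L : ℝ) - b' L) / 2))
      (mem_szSector_rectN_iff n L) (mem_szSector_iff_spinConfig L (a' L) (b' L)) (hBK L h₁) s s' hs hs'
  · exact apply_eq_zero_off_of_mulVec_mem₂ (spinConfig (a' L) (b' L)) (szConfig n L)
      (szSector (a' L + b' L) (((a' L : ℝ) - b' L) / 2)) (szSector (rectN n L) 0)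
      (mem_szSector_iff_spinConfig L (a' L) (b' L)) (mem_szSector_rectN_iff n L) (hBK' L h₁) s s' hs hs'

end Record

end Literature.MathematicalPhysics.QuantumLattice

end
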